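import Literature.Probability.LatticeModels.SahiThirdOrderCorrelation
import Mathlib.Order.Hom.Lattice
import Mathlib.Tactic.Linarith
import HarnessLib
import HarnessLib.Audit

/-!
# `NoHeavyLowerTail` (crux stmt-CriticalPhenomena-4575), Sahi programme P4: relabelling invariance of `latticeE3` and of the FKG class

Support file (cell `prim-l12`, seat P4; `--supports stmt-CriticalPhenomena-4575`).  No named facts, no sorries; standard axioms.

The residual-orbit theorems `SahiC3CubeFourFKG.orbit*_nonneg` are stated for ONE labelled representative per `S₄`-orbit.  To transport them
along a lattice automorphism (for the cube: a permutation of the coordinates) one needs: (1) `latticeE3 μ (e '' U) (e '' A) (e '' B)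
= latticeE3 (μ ∘ e) U A B` for an order isomorphism `e` (`latticeE3_map_orderIso`); (2) `μ ∘ e` is again a nonnegative log-supermodular weight
(`lsm_comp_orderIso`); (3) images of up-sets are up-sets (`isUpperSet_map_orderIso`).  With the symmetry of `latticeE3` in its three slots
(`SahiE3PrincipalMeetFKG.latticeE3_comm₁₂/₂₃`) this is the transport step of the assembly of Sahi's `C₃` on `{0,1}⁴` for FKG weights
(HOME prim-l12-p4/FINDING-gen4-FKG-CUBE4-C3.md §6).
-/

namespace Summit.CriticalPhenomena.PercolationContinuityZ3.Theorems.SahiE3Relabel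

open Finset Literature.Probability.LatticeModels

variable {α β : Type*}

/-- Mass of the image of a set under a bijection `e` for the weight `μ` equals the mass of the set for `μ ∘ e`. [this work] -/
theorem mass_map_equiv (e : α ≃ β) (μ : β → ℝ) (S : Finset α) : mass μ (S.map e.toEmbedding) = mass (μ ∘ e) S := by
  unfold mass; rw [Finset.sum_map]; rfl

/-- The image of `univ` under a bijection is `univ`. [folklore] -/
theorem map_univ_equiv' [Fintype α] [Fintype β] (e : α ≃ β) : (univ : Finset α).map e.toEmbedding = univ :=
  Finset.map_univ_equiv e

/-- Images under an injection commute with intersections. [folklore] -/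
theorem map_inter_equiv [DecidableEq α] [DecidableEq β] (e : α ≃ β) (S T : Finset α) : (S ∩ T).map e.toEmbedding = S.map e.toEmbedding ∩ T.map e.toEmbedding :=
  Finset.map_inter _ _

/-- **Relabelling invariance of `latticeE3`**: for a bijection `e : α ≃ β` of finite types,
`latticeE3 μ (e '' U) (e '' A) (e '' B) = latticeE3 (μ ∘ e) U A B`. [this work] -/
theorem latticeE3_map_equiv [Fintype α] [Fintype β] [DecidableEq α] [DecidableEq β] (e : α ≃ β) (μ : β → ℝ) (U A B : Finset α) :
    latticeE3 μ (U.map e.toEmbedding) (A.map e.toEmbedding) (B.map e.toEmbedding) = latticeE3 (μ ∘ e) U A B := by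
  unfold latticeE3
  rw [← map_inter_equiv, ← map_inter_equiv, ← map_inter_equiv, ← map_inter_equiv, mass_map_equiv, mass_map_equiv, mass_map_equiv,
    mass_map_equiv, mass_map_equiv, mass_map_equiv, mass_map_equiv, ← map_univ_equiv' e, mass_map_equiv]

/-- A log-supermodular weight stays log-supermodular after relabelling by an order isomorphism. [this work] -/
theorem lsm_comp_orderIso [Lattice α] [Lattice β] (e : α ≃o β) {μ : β → ℝ} (hμ : ∀ a b, μ a * μ b ≤ μ (a ⊓ b) * μ (a ⊔ b)) (a b : α) :
    (μ ∘ e) a * (μ ∘ e) b ≤ (μ ∘ e) (a ⊓ b) * (μ ∘ e) (a ⊔ b) := by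
  simp only [Function.comp, e.map_inf, e.map_sup]; exact hμ _ _

/-- Nonnegativity is preserved by relabelling. [folklore] -/
theorem nonneg_comp_orderIso [LE α] [LE β] (e : α ≃o β) {μ : β → ℝ} (hμ₀ : 0 ≤ μ) : 0 ≤ μ ∘ e := fun x => hμ₀ (e x)

/-- The image of an up-set under an order isomorphism is an up-set. [folklore] -/
theorem isUpperSet_map_orderIso [Preorder α] [Preorder β] (e : α ≃o β) {U : Finset α} (hU : IsUpperSet (U : Set α)) :
    IsUpperSet ((U.map e.toEquiv.toEmbedding : Finset β) : Set β) := by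
  intro x y hxy hx
  rw [Finset.mem_coe, Finset.mem_map_equiv] at hx ⊢
  exact hU (by simpa using e.symm.monotone hxy) hx

/-- **Transport of a cube inequality along a relabelling**: if `0 ≤ latticeE3 ν U A B` for every nonnegative log-supermodular `ν` on `α`, then
`0 ≤ latticeE3 μ (e '' U) (e '' A) (e '' B)` for every nonnegative log-supermodular `μ` on `β` and every order isomorphism `e : α ≃o β`.
[this work] -/
theorem latticeE3_nonneg_map_orderIso [Fintype α] [Fintype β] [DecidableEq α] [DecidableEq β] [Lattice α] [Lattice β]
    (e : α ≃o β) {U A B : Finset α}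
    (h : ∀ ν : α → ℝ, 0 ≤ ν → (∀ a b, ν a * ν b ≤ ν (a ⊓ b) * ν (a ⊔ b)) → 0 ≤ latticeE3 ν U A B)
    {μ : β → ℝ} (hμ₀ : 0 ≤ μ) (hμ : ∀ a b, μ a * μ b ≤ μ (a ⊓ b) * μ (a ⊔ b)) :
    0 ≤ latticeE3 μ (U.map e.toEquiv.toEmbedding) (A.map e.toEquiv.toEmbedding) (B.map e.toEquiv.toEmbedding) := by
  rw [latticeE3_map_equiv]
  exact h _ (nonneg_comp_orderIso e hμ₀) (lsm_comp_orderIso e hμ)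

end Summit.CriticalPhenomena.PercolationContinuityZ3.Theorems.SahiE3Relabel
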